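import Summits.MatrixMultiplication.MatrixMultiplication.Theorems.SoloInformedNilpotentUnstable
import Mathlib.LinearAlgebra.JordanChevalley
import Mathlib.RingTheory.Adjoin.Polynomial.Basic
import HarnessLib

/-!
# Maximal asymptotic subrank forces a reduced 111-algebra (Theorem S)

Solo programme `solo-MatrixMultiplication-informed` (gen 19), structural by-product of the closure of
the catalyst door D10 (Theorems N and E of `SoloInformedNilpotentUnstable`).

For a concise `s ∈ ℂ^{d×d×d}` the 111-space `𝔞(s) = {(P,Q,R) : P ·₁ s = Q ·₂ s = R ·₃ s}` contains
`(1,1,1)` and, with a triple `(P,Q,R)`, every `(p(P), p(Q), p(R))`, `p ∈ ℂ[X]` (`IsTriple.aeval`).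
Hence, by the Jordan–Chevalley decomposition, if the first component `P` of some triple is NOT
semisimple then `𝔞(s)` contains a triple whose first component is a non-zero nilpotent, hence
(minimal-power trick + injectivity of the projections) a non-zero square-zero triple, and Theorem N
gives `Q̃(s) < d`:

**Theorem S** (`asymptoticSubrank_lt_card_of_not_isSemisimple`). `s` concise, `(P,Q,R) ∈ 𝔞(s)`,
`P` not semisimple ⟹ `Q̃(s) < d`. Contrapositive (`isSemisimple_of_asymptoticSubrank_eq_card`): a
concise tensor of cubic format with maximal asymptotic subrank `Q̃(s) = d` has a 111-algebra all of
whose elements act semisimply on the first leg — together with commutativity (JLP Thm. 1.10) the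
first projection of `𝔞(s)` is a simultaneously diagonalisable, i.e. reduced, commutative algebra of
dimension `≤ d` (the dimension bound is `NilpotentUnstable.asymptoticSubrank_lt_card_of_card_lt_finrank`).

References: [cite: BlaserLysikov2020, Thm. 16, Thm. 17, §2.3]; [cite: JelisiejewLandsbergPal2023,
Thm. 1.10, Def. 1.9].
-/

open scoped BigOperators Matrix
open Matrix Polynomial

namespace Summit.MatrixMultiplication.MatrixMultiplication.Theorems

open Literature.Computability.AlgebraicComplexity

namespace Semisimple111

open OneOneOneAlgebra NilpotentUnstable

/-! ## Linearity of the contractions; `𝔞(T)` is closed under polynomials in one triple -/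

section Algebra

variable {K : Type*} [Field K] {ι κ μ : Type*} [Fintype ι] [Fintype κ] [Fintype μ]

omit [Fintype κ] [Fintype μ] in
/-- `contract₁` is additive in the matrix. [folklore] -/
theorem contract₁_add (P P' : Matrix ι ι K) (T : ι → κ → μ → K) :
    contract₁ (P + P') T = contract₁ P T + contract₁ P' T := by
  funext z x y
  simp only [contract₁_apply, Pi.add_apply, Matrix.add_apply, add_mul, Finset.sum_add_distrib]

omit [Fintype ι] [Fintype μ] in
/-- `contract₂` is additive in the matrix. [folklore] -/
theorem contract₂_add (Q Q' : Matrix κ κ K) (T : ι → κ → μ → K) :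
    contract₂ (Q + Q') T = contract₂ Q T + contract₂ Q' T := by
  funext z x y
  simp only [contract₂_apply, Pi.add_apply, Matrix.add_apply, add_mul, Finset.sum_add_distrib]

omit [Fintype ι] [Fintype κ] in
/-- `contract₃` is additive in the matrix. [folklore] -/
theorem contract₃_add (Rm Rm' : Matrix μ μ K) (T : ι → κ → μ → K) :
    contract₃ (Rm + Rm') T = contract₃ Rm T + contract₃ Rm' T := by
  funext z x y
  simp only [contract₃_apply, Pi.add_apply, Matrix.add_apply, add_mul, Finset.sum_add_distrib]

omit [Fintype κ] [Fintype μ] in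
/-- `contract₁` is homogeneous in the matrix. [folklore] -/
theorem contract₁_smul (a : K) (P : Matrix ι ι K) (T : ι → κ → μ → K) :
    contract₁ (a • P) T = a • contract₁ P T := by
  funext z x y
  simp only [contract₁_apply, Pi.smul_apply, Matrix.smul_apply, smul_eq_mul, mul_assoc,
    Finset.mul_sum]

omit [Fintype ι] [Fintype μ] in
/-- `contract₂` is homogeneous in the matrix. [folklore] -/
theorem contract₂_smul (a : K) (Q : Matrix κ κ K) (T : ι → κ → μ → K) :
    contract₂ (a • Q) T = a • contract₂ Q T := by
  funext z x y
  simp only [contract₂_apply, Pi.smul_apply, Matrix.smul_apply, smul_eq_mul, mul_assoc,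
    Finset.mul_sum]

omit [Fintype ι] [Fintype κ] in
/-- `contract₃` is homogeneous in the matrix. [folklore] -/
theorem contract₃_smul (a : K) (Rm : Matrix μ μ K) (T : ι → κ → μ → K) :
    contract₃ (a • Rm) T = a • contract₃ Rm T := by
  funext z x y
  simp only [contract₃_apply, Pi.smul_apply, Matrix.smul_apply, smul_eq_mul, mul_assoc,
    Finset.mul_sum]

omit [Fintype κ] [Fintype μ] in
/-- `1 ·₁ T = T`. [folklore] -/
theorem contract₁_one [DecidableEq ι] (T : ι → κ → μ → K) : contract₁ (1 : Matrix ι ι K) T = T := by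
  funext z x y
  simp [contract₁_apply, Matrix.one_apply]

omit [Fintype ι] [Fintype μ] in
/-- `1 ·₂ T = T`. [folklore] -/
theorem contract₂_one [DecidableEq κ] (T : ι → κ → μ → K) : contract₂ (1 : Matrix κ κ K) T = T := by
  funext z x y
  simp [contract₂_apply, Matrix.one_apply]

omit [Fintype ι] [Fintype κ] in
/-- `1 ·₃ T = T`. [folklore] -/
theorem contract₃_one [DecidableEq μ] (T : ι → κ → μ → K) : contract₃ (1 : Matrix μ μ K) T = T := by
  funext z x y
  simp [contract₃_apply, Matrix.one_apply]

/-- `(1,1,1) ∈ 𝔞(T)`. [cite: JelisiejewLandsbergPal2023, Def. 1.9] -/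
theorem isTriple_one [DecidableEq ι] [DecidableEq κ] [DecidableEq μ] (T : ι → κ → μ → K) :
    IsTriple T 1 1 1 := by
  refine ⟨?_, ?_⟩
  · rw [contract₁_one, contract₂_one]
  · rw [contract₂_one, contract₃_one]

/-- `𝔞(T)` is closed under addition. [cite: JelisiejewLandsbergPal2023, Def. 1.9] -/
theorem isTriple_add {T : ι → κ → μ → K} {P P' : Matrix ι ι K} {Q Q' : Matrix κ κ K}
    {Rm Rm' : Matrix μ μ K} (h : IsTriple T P Q Rm) (h' : IsTriple T P' Q' Rm') :
    IsTriple T (P + P') (Q + Q') (Rm + Rm') := by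
  refine ⟨?_, ?_⟩
  · rw [contract₁_add, contract₂_add, h.1, h'.1]
  · rw [contract₂_add, contract₃_add, h.2, h'.2]

/-- `𝔞(T)` is closed under scalars. [cite: JelisiejewLandsbergPal2023, Def. 1.9] -/
theorem isTriple_smul {T : ι → κ → μ → K} {P : Matrix ι ι K} {Q : Matrix κ κ K} {Rm : Matrix μ μ K}
    (h : IsTriple T P Q Rm) (a : K) : IsTriple T (a • P) (a • Q) (a • Rm) := by
  refine ⟨?_, ?_⟩
  · rw [contract₁_smul, contract₂_smul, h.1]
  · rw [contract₂_smul, contract₃_smul, h.2]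

/-- All powers (including the zeroth) of a triple lie in `𝔞(T)`. [cite: JelisiejewLandsbergPal2023, Thm. 1.10] -/
theorem isTriple_pow [DecidableEq ι] [DecidableEq κ] [DecidableEq μ] {T : ι → κ → μ → K}
    {P : Matrix ι ι K} {Q : Matrix κ κ K} {Rm : Matrix μ μ K} (h : IsTriple T P Q Rm) :
    ∀ j : ℕ, IsTriple T (P ^ j) (Q ^ j) (Rm ^ j)
  | 0 => by simpa using isTriple_one T
  | j + 1 => IsTriple.pow h j

/-- **Polynomial closure**: `(P,Q,R) ∈ 𝔞(T)` ⟹ `(p(P), p(Q), p(R)) ∈ 𝔞(T)` for every `p ∈ K[X]`.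
[cite: JelisiejewLandsbergPal2023, Thm. 1.10] -/
theorem isTriple_aeval [DecidableEq ι] [DecidableEq κ] [DecidableEq μ] {T : ι → κ → μ → K}
    {P : Matrix ι ι K} {Q : Matrix κ κ K} {Rm : Matrix μ μ K} (h : IsTriple T P Q Rm) (p : K[X]) :
    IsTriple T (aeval P p) (aeval Q p) (aeval Rm p) := by
  induction p using Polynomial.induction_on' with
  | add p q hp hq => simpa only [map_add] using isTriple_add hp hq
  | monomial n a =>
    simp only [aeval_monomial, ← Algebra.smul_def]
    exact isTriple_smul (isTriple_pow h n) a

/-- From a triple whose first component is a non-zero nilpotent, a non-zero square-zero triple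
(for concise `T`): take the largest non-vanishing power. [cite: JelisiejewLandsbergPal2023, Thm. 1.10] -/
theorem exists_sqZero_triple_of_isNilpotent [DecidableEq ι] [DecidableEq κ] [DecidableEq μ]
    {T : ι → κ → μ → K} (hT : IsConcise3 T) {N : Matrix ι ι K} {Q : Matrix κ κ K} {Rm : Matrix μ μ K}
    (htr : IsTriple T N Q Rm) (hN0 : N ≠ 0) (hNnil : IsNilpotent N) :
    ∃ (P' : Matrix ι ι K) (Q' : Matrix κ κ K) (R' : Matrix μ μ K),
      P' ≠ 0 ∧ P' * P' = 0 ∧ Q' * Q' = 0 ∧ R' * R' = 0 ∧ IsTriple T P' Q' R' := by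
  classical
  have hex : ∃ m : ℕ, N ^ (m + 1) = 0 := by
    obtain ⟨k, hk⟩ := hNnil
    exact ⟨k, by rw [pow_succ, hk, zero_mul]⟩
  let m := Nat.find hex
  have hm : N ^ (m + 1) = 0 := Nat.find_spec hex
  have hm1 : 1 ≤ m := by
    by_contra h0
    rw [show m = 0 by omega, zero_add, pow_one] at hm
    exact hN0 hm
  obtain ⟨j, hj⟩ := Nat.exists_eq_add_of_le hm1
  have hmne : N ^ m ≠ 0 := fun h0 =>
    Nat.find_min hex (show j < m by omega) (by rw [add_comm, ← hj]; exact h0)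
  have hpow := isTriple_pow htr m
  have hP2 : N ^ m * N ^ m = 0 := by
    rw [← pow_add, show m + m = (m + 1) + (m - 1) by omega, pow_add, hm, zero_mul]
  have hpow2 := isTriple_pow htr (m + m)
  have hP2' : contract₁ (N ^ (m + m)) T = 0 := by
    rw [pow_add, hP2]; funext z x y; simp [contract₁_apply]
  have hQ2 : Q ^ m * Q ^ m = 0 := by
    rw [← pow_add]; exact eq_zero_of_contract₂_eq_zero hT.2.1 (hpow2.1 ▸ hP2')
  have hR2 : Rm ^ m * Rm ^ m = 0 := by
    rw [← pow_add]; exact eq_zero_of_contract₃_eq_zero hT.2.2 (hpow2.2 ▸ hpow2.1 ▸ hP2')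
  exact ⟨N ^ m, Q ^ m, Rm ^ m, hmne, hP2, hQ2, hR2, hpow⟩

end Algebra

/-! ## Theorem S -/

section TheoremS

variable {ι κ μ : Type} [Fintype ι] [Fintype κ] [Fintype μ] [DecidableEq ι] [DecidableEq κ]
  [DecidableEq μ]

/-- **Theorem S, polynomial form**: a triple `(P,Q,R) ∈ 𝔞(s)` and a polynomial `p` with `p(P)` a
non-zero nilpotent force `Q̃(s) < d` (concise `s ∈ ℂ^{d×d×d}`). [cite: BlaserLysikov2020, Thm. 16, §2.3] -/
theorem asymptoticSubrank_lt_card_of_isNilpotent_aeval (s : ι → κ → μ → ℂ) (hs : IsConcise3 s)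
    {d : ℕ} (hι : Fintype.card ι = d) (hκ : Fintype.card κ = d) (hμ : Fintype.card μ = d)
    {P : Matrix ι ι ℂ} {Q : Matrix κ κ ℂ} {Rm : Matrix μ μ ℂ} (htr : IsTriple s P Q Rm) (p : ℂ[X])
    (hp0 : aeval P p ≠ 0) (hnil : IsNilpotent (aeval P p)) : asymptoticSubrank ℂ s < d := by
  obtain ⟨P', Q', R', hP0, hP, hQ, hR, htr'⟩ :=
    exists_sqZero_triple_of_isNilpotent hs (isTriple_aeval htr p) hp0 hnil
  exact asymptoticSubrank_lt_card_of_sqZero_triple s hs.1 hι hκ hμ htr' hP0 hP hQ hR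

/-- **Theorem S**: for concise `s ∈ ℂ^{d×d×d}`, a triple `(P,Q,R) ∈ 𝔞(s)` whose first component is
not a semisimple endomorphism of `ℂ^d` forces `Q̃(s) < d` (Jordan–Chevalley: the nilpotent part of
`P` is a non-zero polynomial in `P`). [cite: BlaserLysikov2020, Thm. 16, Thm. 17, §2.3] -/
theorem asymptoticSubrank_lt_card_of_not_isSemisimple (s : ι → κ → μ → ℂ) (hs : IsConcise3 s)
    {d : ℕ} (hι : Fintype.card ι = d) (hκ : Fintype.card κ = d) (hμ : Fintype.card μ = d)
    {P : Matrix ι ι ℂ} {Q : Matrix κ κ ℂ} {Rm : Matrix μ μ ℂ} (htr : IsTriple s P Q Rm)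
    (hP : ¬ Module.End.IsSemisimple (Matrix.toLin' P)) : asymptoticSubrank ℂ s < d := by
  obtain ⟨n, hn, sm, -, hnil, hss, hf⟩ :=
    Module.End.exists_isNilpotent_isSemisimple (f := Matrix.toLin' P)
  have hn0 : n ≠ 0 := by
    rintro rfl
    rw [zero_add] at hf
    exact hP (hf ▸ hss)
  rw [Algebra.adjoin_singleton_eq_range_aeval, AlgHom.mem_range] at hn
  obtain ⟨p, hp⟩ := hn
  -- transport along the algebra isomorphism `Matrix ι ι ℂ ≃ₐ End(ℂ^ι)` (which is `toLin'` on elements)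
  have key : (Matrix.toLinAlgEquiv' : Matrix ι ι ℂ ≃ₐ[ℂ] ((ι → ℂ) →ₗ[ℂ] (ι → ℂ))) (aeval P p) = n := by
    rw [← hp]
    exact (Polynomial.aeval_algHom_apply
      (Matrix.toLinAlgEquiv' : Matrix ι ι ℂ ≃ₐ[ℂ] ((ι → ℂ) →ₗ[ℂ] (ι → ℂ))).toAlgHom P p).symm
  refine asymptoticSubrank_lt_card_of_isNilpotent_aeval s hs hι hκ hμ htr p ?_ ?_
  · intro h0
    exact hn0 (by rw [← key, h0, map_zero])
  · have : IsNilpotent ((Matrix.toLinAlgEquiv' : Matrix ι ι ℂ ≃ₐ[ℂ] ((ι → ℂ) →ₗ[ℂ] (ι → ℂ))).symm n) :=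
      hnil.map _
    simpa [← key] using this

/-- **Corollary**: maximal asymptotic subrank `Q̃(s) = d` of a concise `s ∈ ℂ^{d×d×d}` forces every
element of `𝔞(s)` to act semisimply on the first leg. [cite: BlaserLysikov2020, Thm. 16, Thm. 17] -/
theorem isSemisimple_of_asymptoticSubrank_eq_card (s : ι → κ → μ → ℂ) (hs : IsConcise3 s)
    {d : ℕ} (hι : Fintype.card ι = d) (hκ : Fintype.card κ = d) (hμ : Fintype.card μ = d)
    (hQ : asymptoticSubrank ℂ s = d) {P : Matrix ι ι ℂ} {Q : Matrix κ κ ℂ} {Rm : Matrix μ μ ℂ}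
    (htr : IsTriple s P Q Rm) : Module.End.IsSemisimple (Matrix.toLin' P) := by
  by_contra hP
  have := asymptoticSubrank_lt_card_of_not_isSemisimple s hs hι hκ hμ htr hP
  rw [hQ] at this
  exact lt_irrefl _ this

/-- **Corollary (dimension and reducedness together)**: `Q̃(s) = d` for a concise `s ∈ ℂ^{d×d×d}`
forces `dim 𝔞(s) ≤ d`. [cite: BlaserLysikov2020, Thm. 16, Thm. 17] -/
theorem finrank_ker_lin111_le_of_asymptoticSubrank_eq_card (s : ι → κ → μ → ℂ) (hs : IsConcise3 s)
    {d : ℕ} (hι : Fintype.card ι = d) (hκ : Fintype.card κ = d) (hμ : Fintype.card μ = d)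
    (hQ : asymptoticSubrank ℂ s = d) : Module.finrank ℂ (LinearMap.ker (lin111 s)) ≤ d := by
  by_contra hlt
  have := asymptoticSubrank_lt_card_of_card_lt_finrank s hs hι hκ hμ (by rw [hι]; omega)
  rw [hQ] at this
  exact lt_irrefl _ this

end TheoremS

end Semisimple111

end Summit.MatrixMultiplication.MatrixMultiplication.Theorems
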